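import Literature.AnabelianGeometry.SemiGraphs.ProfiniteHomToAnabPullback
import HarnessLib

/-!
# [SemiAnbd] §2/§3: the fibre functor of `B(𝒢)` defined by a tempered chart, its `π₁^temp(𝒢)`-action,
# and the equivariance of pull-back along a morphism (B7c at the level of fundamental groups)

Mochizuki, *Semi-graphs of anabelioids*, Publ. RIMS **42** (2006), §3 pp. 37–39: "we have natural
full embeddings `B(G) ↪ B^temp(G) ↪ B^cov(G)`" (Def. 3.5 (ii) p. 37), "`B^temp(π₁^temp(G)) ⥲ B^temp(G)`"
(Prop. 3.6 (ii) p. 38), "(iii) The full embedding `B(G) ↪ B^temp(G)` induces an injection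
`π₁^temp(G) ↪ π̂₁(G)` of topological groups" (Prop. 3.6 (iii) p. 38 — here: the HOMOMORPHISM, as the
action of `π₁^temp(G)` on the fibre functor of `B(G)` defined by the chart; its injectivity is the
residual finiteness of `π₁^temp(G)`, not treated here), and Prop. 3.6 (iv) p. 39 ("Any morphism of
semi-graphs of anabelioids `G' → G` induces a morphism of temperoids `B^temp(G') → B^temp(G)` [by
pulling back tempered coverings of `G` to tempered coverings of `G'`]")
[cite: MochizukiSemiAnbd2006, Prop 3.6(iii) p.38].

For a profinite presentation `𝒢` with a chart `c : B^temp(𝒢) ≌ B^temp(Π)` (`TemperedPiChart`,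
`Π = c.G` "=" `π₁^temp(𝒢)`):

* `chartFibre c h𝒢 : B(𝒢.toAnab) ⥤ Type` — the finite étale covering `X` goes to the underlying set
  of `c(X)`: the fibre functor of `B(𝒢)` DEFINED BY THE CHART;
* `chartAction c h𝒢 : Π →* Aut (chartFibre c h𝒢)` — `Π` acts on it (by `ρ`), with open point
  stabilisers: this is the homomorphism `π₁^temp(𝒢) → π̂₁(B(𝒢))` of Prop. 3.6 (iii) at the chart
  basepoint;
* `chartFibreIsoρ` — along a verticial homomorphism `ψ : Π_v → Π` (iso
  `c⁻¹ ⋙ (·)_v ≅ B^temp(ψ)`), `chartFibre ≅` (underlying sets of) the basepoint `ρ_v ⋙ forget` of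
  `B(𝒢.toAnab)` through the vertex `v`, equivariantly for `Π_v` acting through `ψ`;
* **B7c (iii)**: for `F : 𝒢 ⟶ ℋ` and `φ : π₁^temp(𝒢) → π₁^temp(ℋ)` with
  `i : F.chartPullback c𝒢 cℋ ≅ B^temp(φ)` (the body of `Hom.Induces`), the canonical isomorphism
  `chartFibre cℋ ≅ F.toAnab^* ⋙ chartFibre c𝒢` (`Hom.chartFibrePullbackIso`, from
  `ProfiniteHomToAnabPullback.lean`) is `φ`-EQUIVARIANT (`Hom.chartAction_pullback`): the action of
  `φ g` upstairs is carried to the action of `g` on the pulled-back covering — "`φ̂ ∘ ι_𝒢 = ι_ℋ ∘ φ`"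
  on the nose along this transport (abc-iut L3 bridge B7c, Π-level).

Nothing here takes a side on [IUTchIII] Cor. 3.12.
-/

noncomputable section

namespace Literature.AnabelianGeometry.SemiGraphs

open CategoryTheory CategoryTheory.Limits
open Literature.AnabelianGeometry.Anabelioids
open Literature.AlgebraicGeometry.Frobenioids (BCat)
open scoped FintypeCatDiscrete Pointwise

universe u

namespace ProfiniteSemiGraph

variable {𝒢 ℋ : ProfiniteSemiGraph.{u}}

/-! ### The fibre functor of `B(𝒢)` defined by a chart, and its `π₁^temp`-action -/

section Chart

variable (c : TemperedPiChart 𝒢) (h𝒢 : ∀ S : CovObj 𝒢, S.IsFinite → S.IsTempered)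

/-- **The fibre functor of `B(𝒢)` defined by the chart `c`**: a finite étale covering `X ∈ B(𝒢.toAnab)`,
regarded as a tempered covering (`ofBObjTemp`), is carried by the chart to a `π₁^temp(𝒢)`-set `c(X)`;
take its underlying set ([SemiAnbd] Prop. 3.6 (ii)/(iii) pp. 38: `B(G) ↪ B^temp(G) ≃ B^temp(π₁^temp(G))`).
[cite: MochizukiSemiAnbd2006, Prop 3.6(iii) p.38] -/
def chartFibre : 𝒢.toAnab.BObj ⥤ Type u :=
  𝒢.ofBObjTemp h𝒢 ⋙ c.equiv.functor ⋙ (temperedAction c.G).ι ⋙ Action.forget (Type u) c.G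

/-- The chart fibre of `X` is the underlying set of `c(X)` (definitional).
[cite: MochizukiSemiAnbd2006, Prop 3.6(iii) p.38] -/
theorem chartFibre_obj (X : 𝒢.toAnab.BObj) :
    (chartFibre c h𝒢).obj X = (c.equiv.functor.obj ((𝒢.ofBObjTemp h𝒢).obj X)).obj.V := rfl

/-- **The action of `π₁^temp(𝒢)` on the chart fibre functor** — the homomorphism
`π₁^temp(𝒢) → π̂₁(B(𝒢)) = Aut(fibre functor)` of [SemiAnbd] Prop. 3.6 (iii) p. 38 ("the full embedding
`B(G) ↪ B^temp(G)` induces an injection `π₁^temp(G) ↪ π̂₁(G)`"; injectivity not asserted here) at the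
chart basepoint:
`g` acts on every `c(X)` by its structure action `ρ(g)`; naturality in `X` is the equivariance of the
morphisms of `B^temp(π₁^temp(𝒢))`. [cite: MochizukiSemiAnbd2006, Prop 3.6(iii) p.38] -/
def chartAction : c.G →* Aut (chartFibre c h𝒢) where
  toFun g :=
    NatIso.ofComponents
      (fun X => Action.ρAut (c.equiv.functor.obj ((𝒢.ofBObjTemp h𝒢).obj X)).obj g)
      (fun {X Y} f => ((c.equiv.functor.map ((𝒢.ofBObjTemp h𝒢).map f)).hom.comm g).symm)
  map_one' := by
    refine Iso.ext (NatTrans.ext (funext fun X => ?_))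
    exact congrArg Iso.hom (map_one (Action.ρAut (c.equiv.functor.obj ((𝒢.ofBObjTemp h𝒢).obj X)).obj))
  map_mul' g g' := by
    refine Iso.ext (NatTrans.ext (funext fun X => ?_))
    exact congrArg Iso.hom
      (map_mul (Action.ρAut (c.equiv.functor.obj ((𝒢.ofBObjTemp h𝒢).obj X)).obj) g g')

/-- The chart action on elements: `g` acts on `c(X)` by `ρ(g)`. [cite: MochizukiSemiAnbd2006, Prop 3.6(iii) p.38] -/
@[simp] theorem chartAction_hom_app_apply (g : c.G) (X : 𝒢.toAnab.BObj)
    (y : (chartFibre c h𝒢).obj X) :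
    (chartAction c h𝒢 g).hom.app X y =
      (c.equiv.functor.obj ((𝒢.ofBObjTemp h𝒢).obj X)).obj.ρ g y := rfl

/-- **Point stabilisers of the chart action are open** (the objects of `B^temp(Π)` are sets with
CONTINUOUS action, [SemiAnbd] §3 p. 33) — the homomorphism `π₁^temp(𝒢) → Aut(fibre functor)` is
continuous for the profinite topology generated by the point stabilisers.
[cite: MochizukiSemiAnbd2006, §3 p.33] -/
theorem isOpen_stabilizer_chartAction (X : 𝒢.toAnab.BObj) (y : (chartFibre c h𝒢).obj X) :
    IsOpen {g : c.G | (chartAction c h𝒢 g).hom.app X y = y} :=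
  (c.equiv.functor.obj ((𝒢.ofBObjTemp h𝒢).obj X)).property.2 y

/-! ### Comparison with the basepoints through a vertex -/

/-- **The chart fibre functor is the basepoint of `B(𝒢.toAnab)` through the vertex `v`**, along a
verticial homomorphism `ψ : Π_v → π₁^temp(𝒢)` given WITH its defining isomorphism
`e : c⁻¹ ⋙ (·)_v ≅ B^temp(ψ)` ([SemiAnbd] Thm. 3.7 (i) p. 40, `IsVerticialHom`): naturally in `X`,
the underlying set of `c(X)` is the underlying set of the vertex fibre `X_v`
(`|c(X)| = |B^temp(ψ)(c(X))| ≅ |(c⁻¹ c X)_v| ≅ |X_v|`). [cite: MochizukiSemiAnbd2006, Thm 3.7(i) p.40] -/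
def chartFibreIsoρ (v : 𝒢.graph.Vertex) (ψ : 𝒢.Gv v →ₜ* c.G)
    (e : c.equiv.inverse ⋙ ObjectProperty.ι _ ⋙ restrictV 𝒢 v ≅ BTemp.res ψ) :
    chartFibre c h𝒢 ≅
      𝒢.toAnab.ρ v ⋙ ObjectProperty.ι (Action.IsContinuous (V := FintypeCat.{u}) (G := 𝒢.Gv v)) ⋙
        Action.forget FintypeCat.{u} (𝒢.Gv v) ⋙ FintypeCat.incl :=
  -- |c X| = |res ψ (c X)| ≅ |(c⁻¹ (c X))_v| ≅ |(ofBObj X)_v| = |X_v|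
  Functor.isoWhiskerLeft (𝒢.ofBObjTemp h𝒢 ⋙ c.equiv.functor)
      (Functor.isoWhiskerRight e.symm ((temperedAction (𝒢.Gv v)).ι ⋙ Action.forget (Type u) _)) ≪≫
    Functor.isoWhiskerLeft (𝒢.ofBObjTemp h𝒢)
      (Functor.isoWhiskerRight c.equiv.unitIso.symm
        (ObjectProperty.ι _ ⋙ restrictV 𝒢 v ⋙ (temperedAction (𝒢.Gv v)).ι ⋙
          Action.forget (Type u) _))

/-- On elements, `chartFibreIsoρ` is the underlying map of `e⁻¹` at `c(X)` followed by the vertex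
component of the unit isomorphism of the chart. [cite: MochizukiSemiAnbd2006, Thm 3.7(i) p.40] -/
theorem chartFibreIsoρ_hom_app_apply (v : 𝒢.graph.Vertex) (ψ : 𝒢.Gv v →ₜ* c.G)
    (e : c.equiv.inverse ⋙ ObjectProperty.ι _ ⋙ restrictV 𝒢 v ≅ BTemp.res ψ) (X : 𝒢.toAnab.BObj)
    (y : (chartFibre c h𝒢).obj X) :
    (chartFibreIsoρ c h𝒢 v ψ e).hom.app X y =
      ((c.equiv.unitIso.inv.app ((𝒢.ofBObjTemp h𝒢).obj X)).hom.fV v).hom.hom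
        ((e.inv.app (c.equiv.functor.obj ((𝒢.ofBObjTemp h𝒢).obj X))).hom.hom y) := rfl

/-- **Equivariance of `chartFibreIsoρ`**: the chart action of `ψ h` (`h ∈ Π_v`) corresponds to the
structure action `ρ(h)` of `Π_v` on the vertex fibre `X_v` — i.e. `chartAction ∘ ψ` IS the homomorphism `Π_v → Π_𝒢`
of [SemiAnbd] p. 23 at these basepoints ("natural continuous … outer homomorphism
`π̂₁(G_v) → π₁^temp(G)`", Thm. 3.7 (i)). [cite: MochizukiSemiAnbd2006, Thm 3.7(i) p.40] -/
theorem chartFibreIsoρ_equivariant (v : 𝒢.graph.Vertex) (ψ : 𝒢.Gv v →ₜ* c.G)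
    (e : c.equiv.inverse ⋙ ObjectProperty.ι _ ⋙ restrictV 𝒢 v ≅ BTemp.res ψ) (X : 𝒢.toAnab.BObj)
    (h : 𝒢.Gv v) (y : (chartFibre c h𝒢).obj X) :
    (chartFibreIsoρ c h𝒢 v ψ e).hom.app X ((chartAction c h𝒢 (ψ h)).hom.app X y) =
      ConcreteCategory.hom ((X.S v).obj.ρ h) ((chartFibreIsoρ c h𝒢 v ψ e).hom.app X y) := by
  rw [chartFibreIsoρ_hom_app_apply, chartFibreIsoρ_hom_app_apply, chartAction_hom_app_apply]
  -- `e⁻¹` at `c X` is `Π_v`-equivariant from `B^temp(ψ)(c X)` to `(c⁻¹ c X)_v`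
  have h1 := ConcreteCategory.congr_hom
    ((e.inv.app (c.equiv.functor.obj ((𝒢.ofBObjTemp h𝒢).obj X))).hom.comm h) y
  -- the unit isomorphism's vertex component is `Π_v`-equivariant
  have h2 := ConcreteCategory.congr_hom
    (((c.equiv.unitIso.inv.app ((𝒢.ofBObjTemp h𝒢).obj X)).hom.fV v).hom.comm h)
    ((e.inv.app (c.equiv.functor.obj ((𝒢.ofBObjTemp h𝒢).obj X))).hom.hom y)
  exact (congrArg (fun z => ((c.equiv.unitIso.inv.app ((𝒢.ofBObjTemp h𝒢).obj X)).hom.fV v).hom.hom z)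
    h1).trans h2

end Chart

/-! ### B7c (iii): pulling back along `F` is equivariant along the induced homomorphism -/

namespace Hom

variable (F : Hom 𝒢 ℋ) {c𝒢 : TemperedPiChart 𝒢} {cℋ : TemperedPiChart ℋ} {φ : c𝒢.G →ₜ* cℋ.G}
  (h𝒢 : ∀ S : CovObj 𝒢, S.IsFinite → S.IsTempered) (hℋ : ∀ S : CovObj ℋ, S.IsFinite → S.IsTempered)

/-- The DATA form of `chart_res_iso_of_chartPullback_iso`: from an isomorphism
`i : F.chartPullback c𝒢 cℋ ≅ B^temp(φ)` (the body of `Hom.Induces`, [SemiAnbd] Prop. 3.6 (iv) p. 39) the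
isomorphism `ofBObjTemp ⋙ c_ℋ ⋙ B^temp(φ) ≅ F.toAnab^* ⋙ ofBObjTemp ⋙ c_𝒢`.
[cite: MochizukiSemiAnbd2006, Prop 3.6(iv) p.39] -/
def chartResIso (i : F.chartPullback c𝒢 cℋ ≅ BTemp.res φ) :
    ℋ.ofBObjTemp hℋ ⋙ cℋ.equiv.functor ⋙ BTemp.res φ ≅
      F.toAnab.pullbackFunctor ⋙ 𝒢.ofBObjTemp h𝒢 ⋙ c𝒢.equiv.functor :=
  Functor.isoWhiskerLeft _ (Functor.isoWhiskerLeft _ i.symm) ≪≫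
    Functor.isoWhiskerLeft _ (Functor.associator _ _ _).symm ≪≫
    Functor.isoWhiskerLeft _ (Functor.isoWhiskerRight cℋ.equiv.unitIso.symm _) ≪≫
    Functor.isoWhiskerLeft _ (Functor.leftUnitor _) ≪≫
    (Functor.associator _ _ _).symm ≪≫
    Functor.isoWhiskerRight (F.toAnabPullbackIsoTemp h𝒢 hℋ).symm _ ≪≫
    Functor.associator _ _ _

/-- **The canonical isomorphism of chart fibre functors** `chartFibre c_ℋ ≅ F.toAnab^* ⋙ chartFibre c_𝒢`
(forget `chartResIso`; `B^temp(φ)` does not change underlying sets).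
[cite: MochizukiSemiAnbd2006, Prop 3.6(iv) p.39] -/
def chartFibrePullbackIso (i : F.chartPullback c𝒢 cℋ ≅ BTemp.res φ) :
    chartFibre cℋ hℋ ≅ F.toAnab.pullbackFunctor ⋙ chartFibre c𝒢 h𝒢 :=
  Functor.isoWhiskerRight (F.chartResIso h𝒢 hℋ i)
    ((temperedAction c𝒢.G).ι ⋙ Action.forget (Type u) c𝒢.G)

/-- On elements, `chartFibrePullbackIso i` is the underlying map of `chartResIso i`.
[cite: MochizukiSemiAnbd2006, Prop 3.6(iv) p.39] -/
theorem chartFibrePullbackIso_hom_app_apply (i : F.chartPullback c𝒢 cℋ ≅ BTemp.res φ)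
    (X : ℋ.toAnab.BObj) (y : (chartFibre cℋ hℋ).obj X) :
    (F.chartFibrePullbackIso h𝒢 hℋ i).hom.app X y = ((F.chartResIso h𝒢 hℋ i).hom.app X).hom.hom y :=
  rfl

/-- **B7c (iii) — `φ̂ ∘ ι_𝒢 = ι_ℋ ∘ φ` on the nose along the canonical transport** ([SemiAnbd]
Prop. 3.6 (iv) p. 39, compatibility of the induced `π₁^temp(𝒢) → π₁^temp(ℋ)` with the induced morphism
of anabelioids `B(𝒢) → B(ℋ)` on fundamental groups): for `g ∈ π₁^temp(𝒢)`, the action of `φ g` on the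
chart fibre of `X ∈ B(ℋ)` is carried by `chartFibrePullbackIso i` to the action of `g` on the chart fibre
of the pulled-back covering `F.toAnab^* X` — because `(chartResIso i)_X` is a morphism of
`B^temp(π₁^temp(𝒢))`, hence equivariant. [cite: MochizukiSemiAnbd2006, Prop 3.6(iv) p.39] -/
theorem chartAction_pullback (i : F.chartPullback c𝒢 cℋ ≅ BTemp.res φ) (g : c𝒢.G)
    (X : ℋ.toAnab.BObj) (y : (chartFibre cℋ hℋ).obj X) :
    (F.chartFibrePullbackIso h𝒢 hℋ i).hom.app X ((chartAction cℋ hℋ (φ g)).hom.app X y) =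
      (chartAction c𝒢 h𝒢 g).hom.app (F.toAnab.pullbackFunctor.obj X)
        ((F.chartFibrePullbackIso h𝒢 hℋ i).hom.app X y) :=
  ConcreteCategory.congr_hom (((F.chartResIso h𝒢 hℋ i).hom.app X).hom.comm g) y

/-- The same for the inverse transport. [cite: MochizukiSemiAnbd2006, Prop 3.6(iv) p.39] -/
theorem chartAction_pullback_inv (i : F.chartPullback c𝒢 cℋ ≅ BTemp.res φ) (g : c𝒢.G)
    (X : ℋ.toAnab.BObj) (y : (F.toAnab.pullbackFunctor ⋙ chartFibre c𝒢 h𝒢).obj X) :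
    (F.chartFibrePullbackIso h𝒢 hℋ i).inv.app X
        ((chartAction c𝒢 h𝒢 g).hom.app (F.toAnab.pullbackFunctor.obj X) y) =
      (chartAction cℋ hℋ (φ g)).hom.app X ((F.chartFibrePullbackIso h𝒢 hℋ i).inv.app X y) :=
  ConcreteCategory.congr_hom (((F.chartResIso h𝒢 hℋ i).inv.app X).hom.comm g) y

/-- **B7c (iii) in `Aut`-form**: conjugating the whiskered chart action of `g` by the canonical
isomorphism gives the chart action of `φ g`: `J ≫ (F.toAnab^* ◁ ι_𝒢(g)) ≫ J⁻¹ = ι_ℋ(φ g)`.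
[cite: MochizukiSemiAnbd2006, Prop 3.6(iv) p.39] -/
theorem chartFibrePullbackIso_conj (i : F.chartPullback c𝒢 cℋ ≅ BTemp.res φ) (g : c𝒢.G) :
    (F.chartFibrePullbackIso h𝒢 hℋ i).hom ≫
        Functor.whiskerLeft F.toAnab.pullbackFunctor (chartAction c𝒢 h𝒢 g).hom ≫
        (F.chartFibrePullbackIso h𝒢 hℋ i).inv =
      (chartAction cℋ hℋ (φ g)).hom := by
  rw [← Category.assoc, Iso.comp_inv_eq]
  ext X y
  change (Functor.whiskerLeft F.toAnab.pullbackFunctor (chartAction c𝒢 h𝒢 g).hom).app X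
      ((F.chartFibrePullbackIso h𝒢 hℋ i).hom.app X y) =
    (F.chartFibrePullbackIso h𝒢 hℋ i).hom.app X ((chartAction cℋ hℋ (φ g)).hom.app X y)
  exact (F.chartAction_pullback h𝒢 hℋ i g X y).symm

end Hom

end ProfiniteSemiGraph

end Literature.AnabelianGeometry.SemiGraphs

end
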